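import Summits.CriticalPhenomena.PercolationContinuityZ3.Theorems.PercNearOneGluingAdditiveGluingPairStepWinsDominate
import Summits.CriticalPhenomena.PercolationContinuityZ3.Theorems.PercNearOneGluingAdditiveGluingOffObserverKill
import Summits.CriticalPhenomena.PercolationContinuityZ3.Theorems.PercNearOneGluingAdditiveGluingKnThm2GoodEvents
import HarnessLib

/-! # Crux `PercNearOneGluing.AdditiveGluing` (stmt-CriticalPhenomena-4576), line `peel`, stub `stub_toolDeadWinnerAttracts` —
# tool n1p: the dead-conditioned winner attracts the bystander

Support file (`--supports stmt-CriticalPhenomena-4576`); no definitions, no named facts.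

`μ = prodBernoulli u` on the bond configurations of the complete weighted graph `Fin n`; `A` the relay set, `a₀ ∈ A` the
designated relay, `b ∈ A` the target, `s ∉ A` the observer, `x` a bystander; `s dead = ⋂_{a ∈ A} {s ↮ a}`,
`N = {a₀ ↮ s} ⊇ s dead`.
* `stub_toolDeadWinnerAttracts` (**dead-conditioned winner attracts**, tool n1p / census C17 of the Kozma–Nitzan pair step):
  `μ(s dead ∩ a₀↔b) · μ(s↔b ∩ a₀↮s ∩ x↔a₀) ≤ μ(s↔b ∩ a₀↮s) · μ(s dead ∩ a₀↔b ∩ x↔a₀)`.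
  At one relay (`A = {b, a₀}`) this is `pairStep_winner_attracts`; the proof is the same two BHK steps:
  Step A — BHK 2006 Thm 1.3 for the cluster `C(a₀)` given `{a₀ ↮ s}` with the increasing functions `1{x ∈ C(a₀)}` and
  `1{b ∈ C(a₀)} · φ(C(a₀))`, `φ(W) = μ(s reaches no relay outside W by open paths avoiding W)` (the conditional probability
  of `s dead` given `C(a₀) = W`, by the cluster Markov property `offObs_fibre_inter`), giving
  `μ(dead ∩ a₀↔b) · μ(N ∩ a₀↔x) ≤ μ(N) · μ(dead ∩ a₀↔b ∩ a₀↔x)`;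
  Step B — BHK Thm 1.4 (`C_s`, `C_{a₀}` negatively correlated given `{s ↮ a₀}`):
  `μ(N) · μ(N ∩ s↔b ∩ a₀↔x) ≤ μ(N ∩ s↔b) · μ(N ∩ a₀↔x)`; chain and cancel `μ(N)`.
[cite: VandenbergHaggstromKahn2005, Thm. 1.3 (p. 6), Thm. 1.4 (p. 7); KozmaNitzan2024, Lemma 1 (pp. 5–6), §3.2 pp. 12–14]
-/

namespace Summit.CriticalPhenomena.PercolationContinuityZ3.Theorems

open MeasureTheory Set
open Literature.Probability.LatticeModels (prodBernoulli)
open Literature.Probability.Percolation (BondConfig openConn openConnIn openGraph openCluster)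
open scoped BigOperators Classical
noncomputable section

section ToolDeadWinnerAttracts

open Literature.Probability.LatticeModels Literature.Probability.Percolation

variable {n : ℕ}

/-- **BHK Thm 1.3, increasing × increasing, finite-sum form**: for `s ∉ X`, `D = {s ↮ X}` and `φ, ψ` monotone set
functions of the vertex cluster,
`(Σ_T φ(T) μ(D ∩ {C(s)=T})) · (Σ_T ψ(T) μ(D ∩ {C(s)=T})) ≤ μ(D) · Σ_T φ(T)ψ(T) μ(D ∩ {C(s)=T})`.
[cite: VandenbergHaggstromKahn2005, Thm. 1.3 (p. 6)] -/
theorem toolDead_bhk_mono_mono (w : Sym2 (Fin n) → unitInterval) (s : Fin n) (X : Set (Fin n)) (hs : s ∉ X)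
    (φ ψ : Finset (Fin n) → ℝ) (hφ : Monotone φ) (hψ : Monotone ψ) :
    (∑ T : Finset (Fin n), φ T *
          (prodBernoulli w).real ({ω : BondConfig (Fin n) | ∀ x ∈ X, ¬ (openGraph ω).Reachable s x} ∩
            {ω : BondConfig (Fin n) | openCluster ω s = (T : Set (Fin n))})) *
        (∑ T : Finset (Fin n), ψ T *
          (prodBernoulli w).real ({ω : BondConfig (Fin n) | ∀ x ∈ X, ¬ (openGraph ω).Reachable s x} ∩
            {ω : BondConfig (Fin n) | openCluster ω s = (T : Set (Fin n))})) ≤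
      (prodBernoulli w).real {ω : BondConfig (Fin n) | ∀ x ∈ X, ¬ (openGraph ω).Reachable s x} *
        ∑ T : Finset (Fin n), (φ T * ψ T) *
          (prodBernoulli w).real ({ω : BondConfig (Fin n) | ∀ x ∈ X, ¬ (openGraph ω).Reachable s x} ∩
            {ω : BondConfig (Fin n) | openCluster ω s = (T : Set (Fin n))}) := by
  have key := BHK2006_clusterConditionalPositiveAssociation_holds (Fin n) w s X
    (fun C => φ (Finset.univ.filter fun v : Fin n => v = s ∨ ∃ e ∈ C, v ∈ e))
    (fun C => ψ (Finset.univ.filter fun v : Fin n => v = s ∨ ∃ e ∈ C, v ∈ e))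
    (fun C C' h => hφ (offObs_vertF_mono s h)) (fun C C' h => hψ (offObs_vertF_mono s h)) hs
  simp only [offObs_vertF_openEdgeCluster] at key
  rw [offObs_setIntegral_clusterFn w s φ, offObs_setIntegral_clusterFn w s ψ,
    offObs_setIntegral_clusterFn w s (fun T => φ T * ψ T)] at key
  exact key

/-- On a fibre `{C(a₀) = T}`, multiplying by `1{x ∈ T}` intersects with `{a₀ ↔ x}`:
`1{x ∈ T} · μ({C(a₀) = T} ∩ F) = μ({C(a₀) = T} ∩ F ∩ {a₀ ↔ x})`. [folklore] -/
theorem toolDead_hit_mul (u : Sym2 (Fin n) → unitInterval) (a₀ x : Fin n) (T : Finset (Fin n))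
    (F : Set (BondConfig (Fin n))) :
    (if x ∈ T then (1 : ℝ) else 0) *
        (prodBernoulli u).real ({ω : BondConfig (Fin n) | openCluster ω a₀ = (T : Set (Fin n))} ∩ F) =
      (prodBernoulli u).real
        ({ω : BondConfig (Fin n) | openCluster ω a₀ = (T : Set (Fin n))} ∩ (F ∩ openConn a₀ x)) := by
  by_cases hxT : x ∈ T
  · rw [if_pos hxT, one_mul]
    congr 1
    ext ω
    simp only [Set.mem_inter_iff]
    exact ⟨fun h => ⟨h.1, h.2, offObs_fib_subset_openConn a₀ x T hxT h.1⟩, fun h => ⟨h.1, h.2.1⟩⟩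
  · rw [if_neg hxT, zero_mul]
    have h0 : {ω : BondConfig (Fin n) | openCluster ω a₀ = (T : Set (Fin n))} ∩ (F ∩ openConn a₀ x) = ∅ := by
      ext ω
      simp only [Set.mem_inter_iff, Set.mem_empty_iff_false, iff_false, not_and]
      intro hω _ hx
      exact offObs_fib_subset_compl_openConn a₀ x T hxT hω hx
    rw [h0, measureReal_empty]

/-- The event "`s` reaches no relay of `A` outside `T` by an open path avoiding `T`" grows with `T` (fewer relays to
avoid, fewer paths), so `T ↦ 1{b ∈ T} · μ(that event)` is monotone. [folklore] -/
theorem toolDead_phi_mono (u : Sym2 (Fin n) → unitInterval) (A : Finset (Fin n)) (b s : Fin n) :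
    Monotone fun T : Finset (Fin n) => (if b ∈ T then (1 : ℝ) else 0) *
      (prodBernoulli u).real
        {ω : BondConfig (Fin n) | ∀ a ∈ A, a ∉ T → ω ∉ openConnIn ((T : Set (Fin n))ᶜ) s a} := by
  intro T T' hTT'
  have hE : {ω : BondConfig (Fin n) | ∀ a ∈ A, a ∉ T → ω ∉ openConnIn ((T : Set (Fin n))ᶜ) s a} ⊆
      {ω : BondConfig (Fin n) | ∀ a ∈ A, a ∉ T' → ω ∉ openConnIn ((T' : Set (Fin n))ᶜ) s a} := by
    intro ω hω a ha haT' hin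
    refine hω a ha (fun haT => haT' (hTT' haT)) ?_
    exact DCT16.mem_openConnIn_of_pathIn ((DCT16.pathIn_of_mem_openConnIn hin).mono
      (Set.compl_subset_compl.2 (Finset.coe_subset.2 hTT')))
  dsimp only
  by_cases hbT : b ∈ T
  · rw [if_pos hbT, if_pos (hTT' hbT), one_mul, one_mul]
    exact measureReal_mono hE (measure_ne_top _ _)
  · rw [if_neg hbT, zero_mul]
    exact mul_nonneg (by split_ifs <;> norm_num) measureReal_nonneg

/-- The event "`s` reaches no relay of `A` outside `T` avoiding `T`" is determined by the pairs avoiding `T`. [folklore] -/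
theorem toolDead_determinedBy (A : Finset (Fin n)) (s : Fin n) (T : Finset (Fin n)) :
    DeterminedBy {ω : BondConfig (Fin n) | ∀ a ∈ A, a ∉ T → ω ∉ openConnIn ((T : Set (Fin n))ᶜ) s a}
      (↑(Finset.univ.filter fun e : Sym2 (Fin n) => ∀ v ∈ e, v ∉ T) : Set (Sym2 (Fin n))) := by
  rw [determinedBy_iff]
  intro ω ω' h
  simp only [Set.mem_setOf_eq]
  refine forall_congr' fun a => forall_congr' fun _ => forall_congr' fun _ => not_congr ?_
  exact (determinedBy_iff _ _).1 (offObs_determinedBy_openConnIn_compl T s a) ω ω' h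

/-- **Pointwise form of the Markov reduction**: on `{C(a₀) = T}` with `s ∉ T`, the observer `s` is dead (joined to no
relay of `A`) iff it is joined to no relay outside `T` by an open path avoiding `T` — relays inside `T = C(a₀)` are
never reached from `s ∉ C(a₀)`, and an open path from `s` meeting `T` would put `s` into `C(a₀)`. [folklore] -/
theorem toolDead_fib_inter_dead_eq (A : Finset (Fin n)) (a₀ s : Fin n) (T : Finset (Fin n)) (hsT : s ∉ T) :
    {ω : BondConfig (Fin n) | openCluster ω a₀ = (T : Set (Fin n))} ∩ (⋂ a ∈ A, (openConn s a)ᶜ) =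
      {ω : BondConfig (Fin n) | openCluster ω a₀ = (T : Set (Fin n))} ∩
        {ω : BondConfig (Fin n) | ∀ a ∈ A, a ∉ T → ω ∉ openConnIn ((T : Set (Fin n))ᶜ) s a} := by
  ext ω
  simp only [Set.mem_inter_iff, Set.mem_setOf_eq, Set.mem_iInter, Set.mem_compl_iff]
  refine ⟨fun h => ⟨h.1, fun a ha _ hin => h.2 a ha ?_⟩, fun h => ⟨h.1, fun a ha hsa => ?_⟩⟩
  · exact DCT16.reachable_of_pathIn (DCT16.pathIn_of_mem_openConnIn hin)
  · obtain ⟨hω, hE⟩ := h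
    have hsa' : (openGraph ω).Reachable s a := hsa
    -- every vertex joined to `s` lies outside `T = C(a₀)` (else `s ∈ C(a₀) = T`)
    have hout : ∀ y : Fin n, (openGraph ω).Reachable s y → y ∈ ((T : Set (Fin n)))ᶜ := by
      intro y hy hyT
      have ha₀y : y ∈ openCluster ω a₀ := by
        rw [hω]
        exact hyT
      have hs' : s ∈ openCluster ω a₀ := (show (openGraph ω).Reachable a₀ y from ha₀y).trans hy.symm
      rw [hω] at hs'
      exact hsT (Finset.mem_coe.1 hs')
    have haT : a ∉ T := fun haT => hout a hsa' (Finset.mem_coe.2 haT)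
    refine hE a ha haT (DCT16.mem_openConnIn_of_pathIn ?_)
    exact (DCT16.pathIn_restrict_cluster (DCT16.pathIn_univ_of_reachable hsa')).mono
      fun z hz => hout z (DCT16.reachable_of_pathIn hz.2)

/-- **Termwise identification of the `F`-sum**: with `D = {a₀ ↮ s}`, `a₀ ∈ A`, for every vertex set `T`,
`1{b ∈ T} φ(T) · μ(D ∩ {C(a₀) = T}) = μ({C(a₀) = T} ∩ s dead ∩ a₀↔b)` (cluster Markov property on the fibre,
`offObs_fibre_inter`, and `toolDead_fib_inter_dead_eq`). [cite: KozmaNitzan2024, §3.2 (proof of Thm 5, p. 14)] -/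
theorem toolDead_term (u : Sym2 (Fin n) → unitInterval) (A : Finset (Fin n)) (b a₀ s : Fin n) (ha₀ : a₀ ∈ A)
    (T : Finset (Fin n)) :
    ((if b ∈ T then (1 : ℝ) else 0) *
        (prodBernoulli u).real
          {ω : BondConfig (Fin n) | ∀ a ∈ A, a ∉ T → ω ∉ openConnIn ((T : Set (Fin n))ᶜ) s a}) *
      (prodBernoulli u).real ((openConn a₀ s : Set (BondConfig (Fin n)))ᶜ ∩
        {ω : BondConfig (Fin n) | openCluster ω a₀ = (T : Set (Fin n))}) =
    (prodBernoulli u).real ({ω : BondConfig (Fin n) | openCluster ω a₀ = (T : Set (Fin n))} ∩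
      ((⋂ a ∈ A, (openConn s a)ᶜ) ∩ openConn a₀ b)) := by
  by_cases hsT : s ∈ T
  · -- `s ∈ T = C(a₀)` contradicts `a₀ ↮ s` (left) and `s` dead (right, as `a₀ ∈ A`)
    have h1 : (openConn a₀ s : Set (BondConfig (Fin n)))ᶜ ∩
        {ω : BondConfig (Fin n) | openCluster ω a₀ = (T : Set (Fin n))} = ∅ := by
      ext ω
      simp only [Set.mem_inter_iff, Set.mem_compl_iff, Set.mem_empty_iff_false, iff_false, not_and]
      intro hD hω
      exact hD (offObs_fib_subset_openConn a₀ s T hsT hω)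
    have h2 : {ω : BondConfig (Fin n) | openCluster ω a₀ = (T : Set (Fin n))} ∩
        ((⋂ a ∈ A, (openConn s a)ᶜ) ∩ openConn a₀ b) = ∅ := by
      ext ω
      simp only [Set.mem_inter_iff, Set.mem_iInter, Set.mem_compl_iff, Set.mem_empty_iff_false, iff_false,
        not_and]
      intro hω hdead _
      exact hdead a₀ ha₀ (SimpleGraph.Reachable.symm (offObs_fib_subset_openConn a₀ s T hsT hω))
    rw [h1, h2, measureReal_empty, mul_zero]
  · have hD : (openConn a₀ s : Set (BondConfig (Fin n)))ᶜ ∩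
        {ω : BondConfig (Fin n) | openCluster ω a₀ = (T : Set (Fin n))} =
        {ω : BondConfig (Fin n) | openCluster ω a₀ = (T : Set (Fin n))} :=
      Set.inter_eq_right.2 (offObs_fib_subset_compl_openConn a₀ s T hsT)
    rw [hD]
    by_cases ha₀T : a₀ ∈ T
    · by_cases hbT : b ∈ T
      · have hsub : {ω : BondConfig (Fin n) | openCluster ω a₀ = (T : Set (Fin n))} ∩ (⋂ a ∈ A, (openConn s a)ᶜ) ⊆
            openConn a₀ b := Set.inter_subset_left.trans (offObs_fib_subset_openConn a₀ b T hbT)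
        rw [if_pos hbT, one_mul, mul_comm, ← offObs_fibre_inter u a₀ T ha₀T _ (toolDead_determinedBy A s T),
          ← toolDead_fib_inter_dead_eq A a₀ s T hsT, ← Set.inter_assoc, Set.inter_eq_left.2 hsub]
      · have h0 : {ω : BondConfig (Fin n) | openCluster ω a₀ = (T : Set (Fin n))} ∩
            ((⋂ a ∈ A, (openConn s a)ᶜ) ∩ openConn a₀ b) = ∅ := by
          ext ω
          simp only [Set.mem_inter_iff, Set.mem_empty_iff_false, iff_false, not_and]
          intro hω _ hab
          exact offObs_fib_subset_compl_openConn a₀ b T hbT hω hab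
        rw [if_neg hbT, zero_mul, zero_mul, h0, measureReal_empty]
    · rw [offObs_fib_eq_empty a₀ T ha₀T, Set.empty_inter, measureReal_empty, mul_zero]

/-- **Step A** (BHK Thm 1.3 for `C(a₀)` given `{a₀ ↮ s}`, functions `1{b ∈ C(a₀)}·φ(C(a₀))` and `1{x ∈ C(a₀)}`):
`μ(s dead ∩ a₀↔b) · μ(a₀↮s ∩ a₀↔x) ≤ μ(a₀↮s) · μ(s dead ∩ a₀↔b ∩ a₀↔x)`.
[cite: VandenbergHaggstromKahn2005, Thm. 1.3 (p. 6); KozmaNitzan2024, Lemma 1 (pp. 5–6)] -/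
theorem toolDead_stepA (u : Sym2 (Fin n) → unitInterval) (A : Finset (Fin n)) (b a₀ s x : Fin n)
    (ha₀ : a₀ ∈ A) (hs : s ∉ A) :
    (prodBernoulli u).real ((⋂ a ∈ A, (openConn s a)ᶜ) ∩ openConn a₀ b) *
        (prodBernoulli u).real ((openConn a₀ s)ᶜ ∩ openConn a₀ x) ≤
      (prodBernoulli u).real (openConn a₀ s)ᶜ *
        (prodBernoulli u).real ((⋂ a ∈ A, (openConn s a)ᶜ) ∩ openConn a₀ b ∩ openConn a₀ x) := by
  have ha₀s : a₀ ∉ ({s} : Set (Fin n)) := by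
    rw [Set.mem_singleton_iff]
    exact fun h => hs (h ▸ ha₀)
  have hD1 : {ω : BondConfig (Fin n) | ∀ y ∈ ({s} : Set (Fin n)), ¬ (openGraph ω).Reachable a₀ y} =
      (openConn a₀ s : Set (BondConfig (Fin n)))ᶜ := by
    ext ω
    simp only [Set.mem_setOf_eq, Set.mem_singleton_iff, forall_eq, Set.mem_compl_iff]
    rfl
  set Φ : Finset (Fin n) → ℝ := fun T => (if b ∈ T then (1 : ℝ) else 0) *
    (prodBernoulli u).real
      {ω : BondConfig (Fin n) | ∀ a ∈ A, a ∉ T → ω ∉ openConnIn ((T : Set (Fin n))ᶜ) s a} with hΦ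
  set Ψ : Finset (Fin n) → ℝ := fun T => if x ∈ T then (1 : ℝ) else 0 with hΨ
  have key := toolDead_bhk_mono_mono u a₀ ({s} : Set (Fin n)) ha₀s Φ Ψ (toolDead_phi_mono u A b s)
    (offObsChi_monotone x)
  rw [hD1] at key
  have h1 : ∀ T : Finset (Fin n), Φ T * (prodBernoulli u).real ((openConn a₀ s : Set (BondConfig (Fin n)))ᶜ ∩
      {ω : BondConfig (Fin n) | openCluster ω a₀ = (T : Set (Fin n))}) =
      (prodBernoulli u).real ({ω : BondConfig (Fin n) | openCluster ω a₀ = (T : Set (Fin n))} ∩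
        ((⋂ a ∈ A, (openConn s a)ᶜ) ∩ openConn a₀ b)) := fun T => toolDead_term u A b a₀ s ha₀ T
  have h2 : ∀ T : Finset (Fin n), Ψ T * (prodBernoulli u).real ((openConn a₀ s : Set (BondConfig (Fin n)))ᶜ ∩
      {ω : BondConfig (Fin n) | openCluster ω a₀ = (T : Set (Fin n))}) =
      (prodBernoulli u).real ({ω : BondConfig (Fin n) | openCluster ω a₀ = (T : Set (Fin n))} ∩
        ((openConn a₀ s)ᶜ ∩ openConn a₀ x)) := fun T => by
    rw [Set.inter_comm (openConn a₀ s : Set (BondConfig (Fin n)))ᶜ]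
    exact toolDead_hit_mul u a₀ x T _
  have h3 : ∀ T : Finset (Fin n), (Φ T * Ψ T) *
      (prodBernoulli u).real ((openConn a₀ s : Set (BondConfig (Fin n)))ᶜ ∩
        {ω : BondConfig (Fin n) | openCluster ω a₀ = (T : Set (Fin n))}) =
      (prodBernoulli u).real ({ω : BondConfig (Fin n) | openCluster ω a₀ = (T : Set (Fin n))} ∩
        ((⋂ a ∈ A, (openConn s a)ᶜ) ∩ openConn a₀ b ∩ openConn a₀ x)) := fun T => by
    rw [mul_comm (Φ T) (Ψ T), mul_assoc, h1 T]
    exact toolDead_hit_mul u a₀ x T _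
  have hs1 : ∑ T : Finset (Fin n), Φ T * (prodBernoulli u).real ((openConn a₀ s : Set (BondConfig (Fin n)))ᶜ ∩
      {ω : BondConfig (Fin n) | openCluster ω a₀ = (T : Set (Fin n))}) =
      (prodBernoulli u).real ((⋂ a ∈ A, (openConn s a)ᶜ) ∩ openConn a₀ b) := by
    rw [← offObs_sum_fib_inter u a₀ ((⋂ a ∈ A, (openConn s a)ᶜ) ∩ openConn a₀ b)]
    exact Finset.sum_congr rfl fun T _ => h1 T
  have hs2 : ∑ T : Finset (Fin n), Ψ T * (prodBernoulli u).real ((openConn a₀ s : Set (BondConfig (Fin n)))ᶜ ∩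
      {ω : BondConfig (Fin n) | openCluster ω a₀ = (T : Set (Fin n))}) =
      (prodBernoulli u).real ((openConn a₀ s)ᶜ ∩ openConn a₀ x) := by
    rw [← offObs_sum_fib_inter u a₀ ((openConn a₀ s : Set (BondConfig (Fin n)))ᶜ ∩ openConn a₀ x)]
    exact Finset.sum_congr rfl fun T _ => h2 T
  have hs3 : ∑ T : Finset (Fin n), (Φ T * Ψ T) *
      (prodBernoulli u).real ((openConn a₀ s : Set (BondConfig (Fin n)))ᶜ ∩
        {ω : BondConfig (Fin n) | openCluster ω a₀ = (T : Set (Fin n))}) =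
      (prodBernoulli u).real ((⋂ a ∈ A, (openConn s a)ᶜ) ∩ openConn a₀ b ∩ openConn a₀ x) := by
    rw [← offObs_sum_fib_inter u a₀ ((⋂ a ∈ A, (openConn s a)ᶜ) ∩ openConn a₀ b ∩ openConn a₀ x)]
    exact Finset.sum_congr rfl fun T _ => h3 T
  rw [hs1, hs2, hs3] at key
  exact key

/-- **Tool n1p — the dead-conditioned winner attracts the bystander** (registered stub `stub_toolDeadWinnerAttracts` of the
line `peel`, census C17): for `a₀, b ∈ A ∌ s, x`,
`μ(s dead ∩ a₀↔b) · μ(s↔b ∩ a₀↮s ∩ x↔a₀) ≤ μ(s↔b ∩ a₀↮s) · μ(s dead ∩ a₀↔b ∩ x↔a₀)`, `s dead = ⋂_{a ∈ A} {s ↮ a}`.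
Step A (`toolDead_stepA`, BHK Thm 1.3) and Step B (BHK Thm 1.4, `openConn_negCorrelation`) chained through `μ(a₀ ↮ s)`.
[cite: VandenbergHaggstromKahn2005, Thm. 1.3 (p. 6), Thm. 1.4 (p. 7); KozmaNitzan2024, Lemma 1 (pp. 5–6), §3.2 pp. 12–14] -/
theorem stub_toolDeadWinnerAttracts :
    ∀ (n : ℕ) (u : Sym2 (Fin n) → unitInterval) (A : Finset (Fin n)) (b a₀ s x : Fin n) (hb : b ∈ A),
      a₀ ∈ A → s ∉ A → x ∉ A → s ≠ x →
      (prodBernoulli u).real ((⋂ a ∈ A, (openConn s a)ᶜ) ∩ openConn a₀ b)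
        * (prodBernoulli u).real (openConn s b ∩ (openConn a₀ s)ᶜ ∩ openConn x a₀)
      ≤ (prodBernoulli u).real (openConn s b ∩ (openConn a₀ s)ᶜ)
        * (prodBernoulli u).real ((⋂ a ∈ A, (openConn s a)ᶜ) ∩ openConn a₀ b ∩ openConn x a₀) := by
  intro n u A b a₀ s x _hb ha₀ hs _hx _hsx
  have ha₀s : a₀ ≠ s := fun h => hs (h ▸ ha₀)
  -- Step A (BHK Thm 1.3) and Step B (BHK Thm 1.4)
  have hA := toolDead_stepA u A b a₀ s x ha₀ hs
  have hB := BHK2006_twoClusterConditionalAssociation_holds.openConn_negCorrelation (Fin n) u s a₀ b x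
    (Ne.symm ha₀s)
  rw [knThm2_openConn_comm s a₀] at hB
  rw [knThm2_openConn_comm x a₀]
  have e1 : (openConn s b : Set (BondConfig (Fin n))) ∩ (openConn a₀ s)ᶜ ∩ openConn a₀ x =
      (openConn a₀ s)ᶜ ∩ (openConn s b ∩ openConn a₀ x) := by
    rw [Set.inter_comm (openConn s b : Set (BondConfig (Fin n))) (openConn a₀ s)ᶜ, Set.inter_assoc]
  have e2 : (openConn s b : Set (BondConfig (Fin n))) ∩ (openConn a₀ s)ᶜ = (openConn a₀ s)ᶜ ∩ openConn s b :=
    Set.inter_comm _ _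
  rw [e1, e2]
  -- algebra: `P·Ax ≤ d·S` (A) and `d·Q ≤ R·Ax` (B) give `d·(P·Q) ≤ d·(R·S)`; cancel `d` (or `Q ≤ d = 0`)
  set d := (prodBernoulli u).real (openConn a₀ s : Set (BondConfig (Fin n)))ᶜ with hd
  set P := (prodBernoulli u).real ((⋂ a ∈ A, (openConn s a)ᶜ) ∩ openConn a₀ b) with hP
  set Q := (prodBernoulli u).real ((openConn a₀ s : Set (BondConfig (Fin n)))ᶜ ∩ (openConn s b ∩ openConn a₀ x))
    with hQ
  set R := (prodBernoulli u).real ((openConn a₀ s : Set (BondConfig (Fin n)))ᶜ ∩ openConn s b) with hR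
  set Ax := (prodBernoulli u).real ((openConn a₀ s : Set (BondConfig (Fin n)))ᶜ ∩ openConn a₀ x) with hAx
  set S := (prodBernoulli u).real ((⋂ a ∈ A, (openConn s a)ᶜ) ∩ openConn a₀ b ∩ openConn a₀ x) with hS
  have hP0 : 0 ≤ P := measureReal_nonneg
  have hR0 : 0 ≤ R := measureReal_nonneg
  have hS0 : 0 ≤ S := measureReal_nonneg
  have hQ0 : 0 ≤ Q := measureReal_nonneg
  have hQ_le : Q ≤ d := measureReal_mono Set.inter_subset_left (measure_ne_top _ _)
  have h1 : d * (P * Q) ≤ P * (R * Ax) := by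
    have := mul_le_mul_of_nonneg_left hB hP0
    linarith
  have h2 : P * (R * Ax) ≤ d * (R * S) := by
    have := mul_le_mul_of_nonneg_left hA hR0
    linarith
  by_cases hd0 : d = 0
  · have hQ' : Q = 0 := le_antisymm (hd0 ▸ hQ_le) hQ0
    rw [hQ', mul_zero]
    exact mul_nonneg hR0 hS0
  · have hdpos : 0 < d := lt_of_le_of_ne measureReal_nonneg (Ne.symm hd0)
    exact le_of_mul_le_mul_left (h1.trans h2) hdpos

end ToolDeadWinnerAttracts

end

end Summit.CriticalPhenomena.PercolationContinuityZ3.Theorems
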